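import Literature.NumberTheory.Automorphic.BrandtModuleResidue
import HarnessLib

/-!
# The residue ring `O / p O`: Peirce decomposition, zero divisors, idempotents and nilpotents

Fourth layer of the proof files for the named fact `brandtMatrix_comm` of `BrandtModule.lean`
(Vignéras, LNM 800, III §5 ex. 5.8; Eichler 1973, II §6 Thm. 2). We begin the *residual*
substitute for the local classification of maximal orders (Vignéras II §§1–2: `O_p ≅ M₂(ℤ_p)`,
or `O_p` is the maximal order of the local division algebra): the structure of the finite ring
`A = O / p O` of a `ℤ`-order `O` in a quaternion algebra over `ℚ` (`IsZOrder.Residue`,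
`BrandtModuleResidue.lean`). Contents:

* congruence bookkeeping in `B` for the lattices `m • O` (`IsZOrder.mul_mem_smul_of_mem`, …,
  `IsZOrder.mem_smul_of_smul_mem_smul` — division by `p` in the torsion-free `O`);
* the quaternionic identities *in* `A`: `(res x)² = t · res x − n` (`IsZOrder.res_mul_res`),
  `res x · res x̄ = n = res x̄ · res x`, scalars `(k : A) = 0 ↔ p ∣ k`
  (`IsZOrder.intCast_residue_eq_zero_iff`, via **`1 ∉ p O`**: `nrd` of `1/p` is not integral),
  units: `p ∤ nrd x → res x` is a unit;
* **Peirce decomposition** for an idempotent `e` of any ring `R` with `f = 1 − e`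
  (`peirceCorner`, `peirceEquiv : R ≃ eRe × eRf × fRe × fRf`, `card_eq_prod_card_peirceCorner`);
* in `A`: a non-trivial idempotent `e = res x` has `p ∣ n(x)`, `t(x) ≡ 1`, hence **`ē = 1 − e`**
  (`IsZOrder.res_bar_eq_one_sub`); elements of `e A f` square to zero; and the dichotomy seeded by
  the isotropic vector of `BrandtModuleResidue`: **`A` has a non-trivial idempotent or a non-zero
  element of square zero** (`IsZOrder.exists_idempotent_or_sq_zero`).

## References

* M.-F. Vignéras, *Arithmétique des algèbres de quaternions*, LNM 800 (1980), Ch. I §1, Ch. II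
  §§1–2 [VignerasLNM800].
* N. Jacobson, *Basic Algebra II* (1989), §4.? (Peirce decomposition) — background [folklore].
-/

noncomputable section

open scoped Pointwise

universe u

namespace Literature.NumberTheory.Automorphic

/-! ### Peirce decomposition with respect to an idempotent (any ring) -/

section Peirce

variable {R : Type u} [Ring R]

/-- The **Peirce corner** `e R e'` of a ring with respect to two elements (idempotents in
practice), as an additive subgroup: `{a | e a e' = a}`. [folklore] -/
def peirceCorner (e e' : R) : AddSubgroup R where
  carrier := {a | e * a * e' = a}
  add_mem' {a b} ha hb := by
    change e * (a + b) * e' = a + b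
    rw [mul_add, add_mul, ha, hb]
  zero_mem' := by
    change e * 0 * e' = 0
    rw [mul_zero, zero_mul]
  neg_mem' {a} ha := by
    change e * -a * e' = -a
    rw [mul_neg, neg_mul, ha]

/-- Membership in a Peirce corner (definitional). [folklore] -/
theorem mem_peirceCorner {e e' a : R} : a ∈ peirceCorner e e' ↔ e * a * e' = a := Iff.rfl

/-- For idempotents, `e b e' ∈ e R e'`. [folklore] -/
theorem mul_mul_mem_peirceCorner {e e' : R} (he : IsIdempotentElem e) (he' : IsIdempotentElem e')
    (b : R) : e * b * e' ∈ peirceCorner e e' := by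
  change e * (e * b * e') * e' = e * b * e'
  rw [← mul_assoc, ← mul_assoc, he.eq, mul_assoc, he'.eq]

/-- `e x = x` for `x ∈ e R e'` (`e` idempotent). [folklore] -/
theorem mul_left_eq_self_of_mem_peirceCorner {e e' x : R} (he : IsIdempotentElem e)
    (hx : x ∈ peirceCorner e e') : e * x = x := by
  rw [mem_peirceCorner] at hx
  conv_lhs => rw [← hx]
  rw [← mul_assoc, ← mul_assoc, he.eq, hx]

/-- `x e' = x` for `x ∈ e R e'` (`e'` idempotent). [folklore] -/
theorem mul_right_eq_self_of_mem_peirceCorner {e e' x : R} (he' : IsIdempotentElem e')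
    (hx : x ∈ peirceCorner e e') : x * e' = x := by
  rw [mem_peirceCorner] at hx
  conv_lhs => rw [← hx]
  rw [mul_assoc, he'.eq, hx]

/-- `g x = 0` for `x ∈ e R e'` whenever `g e = 0`. [folklore] -/
theorem mul_left_eq_zero_of_mem_peirceCorner {e e' x g : R} (hx : x ∈ peirceCorner e e')
    (h : g * e = 0) : g * x = 0 := by
  rw [mem_peirceCorner] at hx
  rw [← hx, ← mul_assoc, ← mul_assoc, h, zero_mul, zero_mul]

/-- `x g = 0` for `x ∈ e R e'` whenever `e' g = 0`. [folklore] -/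
theorem mul_right_eq_zero_of_mem_peirceCorner {e e' x g : R} (hx : x ∈ peirceCorner e e')
    (h : e' * g = 0) : x * g = 0 := by
  rw [mem_peirceCorner] at hx
  rw [← hx, mul_assoc, h, mul_zero]

/-- **Peirce decomposition** `R ≃ eRe × eRf × fRe × fRf` (`f = 1 − e`) as additive groups:
`a ↦ (eae, eaf, fae, faf)` with inverse the sum. [folklore] -/
def peirceEquiv {e : R} (he : IsIdempotentElem e) :
    R ≃ peirceCorner e e × peirceCorner e (1 - e) × peirceCorner (1 - e) e ×
      peirceCorner (1 - e) (1 - e) where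
  toFun a := (⟨e * a * e, mul_mul_mem_peirceCorner he he a⟩,
    ⟨e * a * (1 - e), mul_mul_mem_peirceCorner he he.one_sub a⟩,
    ⟨(1 - e) * a * e, mul_mul_mem_peirceCorner he.one_sub he a⟩,
    ⟨(1 - e) * a * (1 - e), mul_mul_mem_peirceCorner he.one_sub he.one_sub a⟩)
  invFun q := (q.1 : R) + q.2.1 + q.2.2.1 + q.2.2.2
  left_inv a := by
    change e * a * e + e * a * (1 - e) + (1 - e) * a * e + (1 - e) * a * (1 - e) = a
    noncomm_ring
  right_inv q := by
    obtain ⟨⟨a, ha⟩, ⟨b, hb⟩, ⟨c, hc⟩, ⟨d, hd⟩⟩ := q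
    have hf := he.one_sub
    have hef : e * (1 - e) = 0 := he.mul_one_sub_self
    have hfe : (1 - e) * e = 0 := he.one_sub_mul_self
    -- each component of the sum is recovered by its two-sided projection
    have h1 : e * (a + b + c + d) * e = a := by
      simp only [mul_add, add_mul, mul_left_eq_self_of_mem_peirceCorner he ha,
        mul_right_eq_self_of_mem_peirceCorner he ha, mul_left_eq_self_of_mem_peirceCorner he hb,
        mul_right_eq_zero_of_mem_peirceCorner hb hfe, mul_left_eq_zero_of_mem_peirceCorner hc hef,
        mul_left_eq_zero_of_mem_peirceCorner hd hef, add_zero]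
    have h2 : e * (a + b + c + d) * (1 - e) = b := by
      simp only [mul_add, add_mul, mul_left_eq_self_of_mem_peirceCorner he ha,
        mul_right_eq_zero_of_mem_peirceCorner ha hef, mul_left_eq_self_of_mem_peirceCorner he hb,
        mul_right_eq_self_of_mem_peirceCorner hf hb, mul_left_eq_zero_of_mem_peirceCorner hc hef,
        mul_left_eq_zero_of_mem_peirceCorner hd hef, add_zero, zero_add]
    have h3 : (1 - e) * (a + b + c + d) * e = c := by
      simp only [mul_add, add_mul, mul_left_eq_zero_of_mem_peirceCorner ha hfe,
        mul_left_eq_zero_of_mem_peirceCorner hb hfe, mul_left_eq_self_of_mem_peirceCorner hf hc,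
        mul_right_eq_self_of_mem_peirceCorner he hc, mul_left_eq_self_of_mem_peirceCorner hf hd,
        mul_right_eq_zero_of_mem_peirceCorner hd hfe, add_zero, zero_add]
    have h4 : (1 - e) * (a + b + c + d) * (1 - e) = d := by
      simp only [mul_add, add_mul, mul_left_eq_zero_of_mem_peirceCorner ha hfe,
        mul_left_eq_zero_of_mem_peirceCorner hb hfe, mul_left_eq_self_of_mem_peirceCorner hf hc,
        mul_right_eq_zero_of_mem_peirceCorner hc hef, mul_left_eq_self_of_mem_peirceCorner hf hd,
        mul_right_eq_self_of_mem_peirceCorner hf hd, zero_add]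
    exact Prod.ext (Subtype.ext h1) (Prod.ext (Subtype.ext h2) (Prod.ext (Subtype.ext h3) (Subtype.ext h4)))

/-- **Cardinality of the Peirce decomposition**: `|R| = |eRe| |eRf| |fRe| |fRf|`. [folklore] -/
theorem card_eq_prod_card_peirceCorner {e : R} (he : IsIdempotentElem e) :
    Nat.card R = Nat.card (peirceCorner e e) * Nat.card (peirceCorner e (1 - e)) *
      Nat.card (peirceCorner (1 - e) e) * Nat.card (peirceCorner (1 - e) (1 - e)) := by
  rw [Nat.card_congr (peirceEquiv he), Nat.card_prod, Nat.card_prod, Nat.card_prod]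
  ring

/-- `(e R e') (e' R e'') ⊆ e R e''` for idempotents. [folklore] -/
theorem mul_mem_peirceCorner {e e' e'' : R} {a b : R} (ha : a ∈ peirceCorner e e')
    (hb : b ∈ peirceCorner e' e'') (he : IsIdempotentElem e) (he'' : IsIdempotentElem e'') :
    a * b ∈ peirceCorner e e'' := by
  rw [mem_peirceCorner] at ha hb ⊢
  rw [← ha, ← hb]
  have : e * (e * a * e' * (e' * b * e'')) * e'' = (e * e) * a * e' * (e' * b * (e'' * e'')) := by
    noncomm_ring
  rw [this, he.eq, he''.eq]

/-- `(e R e') (e'' R e''') = 0` when `e' e'' = 0`. [folklore] -/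
theorem mul_eq_zero_of_mem_peirceCorner {e e' e'' e''' : R} {a b : R} (ha : a ∈ peirceCorner e e')
    (hb : b ∈ peirceCorner e'' e''') (h : e' * e'' = 0) : a * b = 0 := by
  rw [mem_peirceCorner] at ha hb
  rw [← ha, ← hb]
  have : e * a * e' * (e'' * b * e''') = e * a * (e' * e'') * b * e''' := by noncomm_ring
  rw [this, h, mul_zero, zero_mul, zero_mul]

/-- Products of off-diagonal Peirce elements: `(e R f)(e R f) = 0`. [folklore] -/
theorem mul_eq_zero_of_mem_peirceCorner_off {e : R} (he : IsIdempotentElem e) {a b : R}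
    (ha : a ∈ peirceCorner e (1 - e)) (hb : b ∈ peirceCorner e (1 - e)) : a * b = 0 :=
  mul_eq_zero_of_mem_peirceCorner ha hb he.one_sub_mul_self

/-- Products of off-diagonal Peirce elements: `(f R e)(f R e) = 0`. [folklore] -/
theorem mul_eq_zero_of_mem_peirceCorner_off' {e : R} (he : IsIdempotentElem e) {a b : R}
    (ha : a ∈ peirceCorner (1 - e) e) (hb : b ∈ peirceCorner (1 - e) e) : a * b = 0 :=
  mul_eq_zero_of_mem_peirceCorner ha hb he.mul_one_sub_self

end Peirce

/-! ### Congruences modulo `m • O` in the ambient ring -/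

namespace IsZOrder

section Ring

variable {B : Type u} [Ring B] {O : Submodule ℤ B}

/-- `m • O ≤ O`. [folklore] -/
theorem smul_le (O : Submodule ℤ B) (m : ℤ) : m • O ≤ O := fun x hx => by
  obtain ⟨y, hy, rfl⟩ := (Submodule.mem_smul_pointwise_iff_exists x m O).mp hx
  exact O.smul_mem m hy

/-- `(m • O) O ⊆ m • O` for an order: `x ∈ m • O`, `y ∈ O` give `x y ∈ m • O`. [folklore] -/
theorem smul_mul_mem (hO : IsZOrder O) {m : ℤ} {x y : B} (hx : x ∈ m • O) (hy : y ∈ O) :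
    x * y ∈ m • O := by
  obtain ⟨x', hx', rfl⟩ := (Submodule.mem_smul_pointwise_iff_exists x m O).mp hx
  rw [smul_mul_assoc]
  exact Submodule.smul_mem_pointwise_smul _ m O (hO.mul_mem _ hx' _ hy)

/-- `O (m • O) ⊆ m • O` for an order. [folklore] -/
theorem mul_smul_mem (hO : IsZOrder O) {m : ℤ} {x y : B} (hx : x ∈ O) (hy : y ∈ m • O) :
    x * y ∈ m • O := by
  obtain ⟨y', hy', rfl⟩ := (Submodule.mem_smul_pointwise_iff_exists y m O).mp hy
  rw [mul_smul_comm]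
  exact Submodule.smul_mem_pointwise_smul _ m O (hO.mul_mem _ hx _ hy')

/-- `(m • O)(n • O) ⊆ (m n) • O` for an order. [folklore] -/
theorem smul_mul_smul_mem (hO : IsZOrder O) {m n : ℤ} {x y : B} (hx : x ∈ m • O) (hy : y ∈ n • O) :
    x * y ∈ (m * n) • O := by
  obtain ⟨x', hx', rfl⟩ := (Submodule.mem_smul_pointwise_iff_exists x m O).mp hx
  obtain ⟨y', hy', rfl⟩ := (Submodule.mem_smul_pointwise_iff_exists y n O).mp hy
  rw [smul_mul_smul_comm]
  exact Submodule.smul_mem_pointwise_smul _ _ O (hO.mul_mem _ hx' _ hy')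

/-- `(m n) • O ≤ m • O`. [folklore] -/
theorem smul_smul_le (O : Submodule ℤ B) (m n : ℤ) : (m * n) • O ≤ m • O := fun x hx => by
  obtain ⟨y, hy, rfl⟩ := (Submodule.mem_smul_pointwise_iff_exists x _ O).mp hx
  rw [mul_smul]
  exact Submodule.smul_mem_pointwise_smul _ m O (O.smul_mem n hy)

/-- **Division by `m`** in a torsion-free order: if `m • z ∈ (m n) • O` with `m ≠ 0` then
`z ∈ n • O`. [folklore] -/
theorem mem_smul_of_smul_mem_smul [IsAddTorsionFree B] (O : Submodule ℤ B) {m n : ℤ} (hm : m ≠ 0)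
    {z : B} (hz : m • z ∈ (m * n) • O) : z ∈ n • O := by
  obtain ⟨y, hy, hzy⟩ := (Submodule.mem_smul_pointwise_iff_exists _ _ O).mp hz
  rw [mul_smul] at hzy
  have : z = n • y := smul_right_injective B hm hzy.symm
  rw [this]
  exact Submodule.smul_mem_pointwise_smul _ n O hy

end Ring

/-! ### Quaternionic identities in `A = O / p O` -/

section Residue

variable {B : Type u} [Ring B] [Algebra ℚ B] [IsQuaternionAlgebra ℚ B] {O : Submodule ℤ B}

/-- `x̄` as an element of the subring of an order. [folklore] -/
def barS (hO : IsZOrder O) (x : hO.subring) : hO.subring :=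
  ⟨standardInvolution ℚ B x, hO.standardInvolution_mem x.2⟩

/-- `x̄ = t(x) − x` in the subring. [folklore] -/
theorem barS_eq (hO : IsZOrder O) (x : hO.subring) : hO.barS x = (trdZ (x : B) : hO.subring) - x := by
  apply Subtype.ext
  change standardInvolution ℚ B x = ((trdZ (x : B) : hO.subring) - x : hO.subring)
  rw [AddSubgroupClass.coe_sub, Subring.coe_intCast, hO.standardInvolution_eq x.2, zsmul_eq_mul, mul_one]

/-- `x² = t(x) x − n(x)` in the subring. [cite: VignerasLNM800, Ch. I §1 Lemme 1.1] -/
theorem mul_self_subring (hO : IsZOrder O) (x : hO.subring) :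
    x * x = (trdZ (x : B) : hO.subring) * x - (nrdZ (x : B) : hO.subring) :=
  Subtype.ext (by
    rw [Subring.coe_mul, AddSubgroupClass.coe_sub, Subring.coe_mul, Subring.coe_intCast,
      Subring.coe_intCast, hO.mul_self_eq_trdZ x.2, zsmul_eq_mul, zsmul_eq_mul, mul_one])

/-- `x x̄ = n(x)` in the subring. [cite: VignerasLNM800, Ch. I §1 Lemme 1.1] -/
theorem mul_barS (hO : IsZOrder O) (x : hO.subring) : x * hO.barS x = (nrdZ (x : B) : hO.subring) :=
  Subtype.ext (by
    rw [Subring.coe_mul, Subring.coe_intCast, barS, hO.mul_standardInvolution_eq x.2, zsmul_eq_mul, mul_one])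

/-- `x̄ x = n(x)` in the subring. [cite: VignerasLNM800, Ch. I §1 Lemme 1.1] -/
theorem barS_mul (hO : IsZOrder O) (x : hO.subring) : hO.barS x * x = (nrdZ (x : B) : hO.subring) :=
  Subtype.ext (by
    rw [Subring.coe_mul, Subring.coe_intCast, barS, hO.standardInvolution_mul_eq x.2, zsmul_eq_mul, mul_one])

variable {p : ℕ}

/-- **`(res x)² = t(x) · res x − n(x)`** in `O / p O`. [cite: VignerasLNM800, Ch. I §1 Lemme 1.1] -/
theorem res_mul_res (hO : IsZOrder O) (x : hO.subring) :
    hO.res p x * hO.res p x = (trdZ (x : B) : hO.Residue p) * hO.res p x - (nrdZ (x : B) : hO.Residue p) := by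
  rw [← map_mul, hO.mul_self_subring x, map_sub, map_mul, map_intCast, map_intCast]

/-- `res x · res x̄ = n(x)` in `O / p O`. [cite: VignerasLNM800, Ch. I §1 Lemme 1.1] -/
theorem res_mul_res_barS (hO : IsZOrder O) (x : hO.subring) :
    hO.res p x * hO.res p (hO.barS x) = (nrdZ (x : B) : hO.Residue p) := by
  rw [← map_mul, hO.mul_barS, map_intCast]

/-- `res x̄ · res x = n(x)` in `O / p O`. [cite: VignerasLNM800, Ch. I §1 Lemme 1.1] -/
theorem res_barS_mul_res (hO : IsZOrder O) (x : hO.subring) :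
    hO.res p (hO.barS x) * hO.res p x = (nrdZ (x : B) : hO.Residue p) := by
  rw [← map_mul, hO.barS_mul, map_intCast]

/-- `res x̄ = t(x) − res x`. [folklore] -/
theorem res_barS (hO : IsZOrder O) (x : hO.subring) :
    hO.res p (hO.barS x) = (trdZ (x : B) : hO.Residue p) - hO.res p x := by
  rw [hO.barS_eq, map_sub, map_intCast]

/-- **`1 ∉ p O` for `p ≥ 2`**: otherwise `1/p ∈ O` would have integral reduced norm `1/p²`. [folklore] -/
theorem one_not_mem_smul (hO : IsZOrder O) {m : ℤ} (hm : 1 < m) : (1 : B) ∉ m • O := by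
  intro h
  obtain ⟨y, hy, hy1⟩ := (Submodule.mem_smul_pointwise_iff_exists _ _ O).mp h
  have h1 : nrdZ (m • y) = (1 : ℤ) := by rw [hy1]; exact nrdZ_one
  rw [hO.nrdZ_zsmul m hy] at h1
  have hdvd : m ∣ 1 := ⟨m * nrdZ y, by rw [← h1]; ring⟩
  exact absurd (Int.eq_one_of_dvd_one (by omega) hdvd) (by omega)

/-- For a prime `p` not dividing `k`, `p` and `k` are coprime integers. [folklore] -/
theorem isCoprime_natCast_of_not_dvd (hp : p.Prime) {k : ℤ} (h : ¬ (p : ℤ) ∣ k) :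
    IsCoprime (p : ℤ) k := by
  rw [Int.isCoprime_iff_gcd_eq_one]
  change Nat.gcd (p : ℤ).natAbs k.natAbs = 1
  rw [Int.natAbs_natCast]
  exact (Nat.Prime.coprime_iff_not_dvd hp).mpr fun h' => h (Int.natCast_dvd.mpr h')

/-- `1 ≠ 0` in `O / p O` for `p ≥ 2`. [folklore] -/
theorem one_ne_zero_residue (hO : IsZOrder O) (hp : 1 < p) : (1 : hO.Residue p) ≠ 0 := by
  intro h
  rw [← map_one (hO.res p), res_eq_zero_iff, Subring.coe_one] at h
  exact hO.one_not_mem_smul (by exact_mod_cast hp) h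

/-- **Scalars in `O / p O`**: `(k : O / p O) = 0 ↔ p ∣ k` for a prime `p` (the image of `ℤ` in
`O / p O` is `𝔽_p`): Bezout and `1 ≠ 0`. [folklore] -/
theorem intCast_residue_eq_zero_iff (hO : IsZOrder O) (hp : p.Prime) {k : ℤ} :
    (k : hO.Residue p) = 0 ↔ (p : ℤ) ∣ k := by
  constructor
  · intro hk
    by_contra hndvd
    obtain ⟨u, v, huv⟩ := isCoprime_natCast_of_not_dvd hp hndvd
    apply hO.one_ne_zero_residue hp.one_lt
    have h := congrArg (fun z : ℤ => (z : hO.Residue p)) huv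
    simp only [Int.cast_add, Int.cast_mul, Int.cast_natCast, natCast_self_residue, mul_zero, zero_add,
      Int.cast_one, hk] at h
    exact h.symm
  · rintro ⟨c, rfl⟩
    rw [Int.cast_mul, Int.cast_natCast, natCast_self_residue, zero_mul]

omit [Algebra ℚ B] [IsQuaternionAlgebra ℚ B] in
/-- An integer inverse modulo `p`: if `p ∤ k` there is `l` with `(l : O/pO) (k : O/pO) = 1`. [folklore] -/
theorem exists_intCast_mul_eq_one (hO : IsZOrder O) (hp : p.Prime) {k : ℤ} (h : ¬ (p : ℤ) ∣ k) :
    ∃ l : ℤ, (l : hO.Residue p) * (k : hO.Residue p) = 1 := by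
  obtain ⟨u, v, huv⟩ := isCoprime_natCast_of_not_dvd hp h
  refine ⟨v, ?_⟩
  have hc := congrArg (fun z : ℤ => (z : hO.Residue p)) huv
  simpa only [Int.cast_add, Int.cast_mul, Int.cast_natCast, natCast_self_residue, mul_zero, zero_add,
    Int.cast_one] using hc

/-- **Units of `O / p O`**: if `p ∤ n(x)` then `res x` is a unit, with inverse `l · res x̄` where
`l n(x) ≡ 1 (mod p)`. [cite: VignerasLNM800, Ch. I §1 Lemme 1.1] -/
theorem isUnit_res_of_not_dvd (hO : IsZOrder O) (hp : p.Prime) {x : hO.subring}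
    (hx : ¬ (p : ℤ) ∣ nrdZ (x : B)) : IsUnit (hO.res p x) := by
  obtain ⟨l, hl⟩ := hO.exists_intCast_mul_eq_one hp hx
  refine isUnit_iff_exists.mpr ⟨(l : hO.Residue p) * hO.res p (hO.barS x), ?_, ?_⟩
  · rw [← mul_assoc, ← (Int.cast_commute l _).eq, mul_assoc, res_mul_res_barS, hl]
  · rw [mul_assoc, res_barS_mul_res, hl]

/-- A zero divisor from the isotropic vector: `res x₀ ≠ 0` with `p ∣ n(x₀)`. [folklore] -/
theorem exists_res_ne_zero_dvd_nrdZ (hO : IsZOrder O) (hp : p.Prime) :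
    ∃ x : hO.subring, hO.res p x ≠ 0 ∧ (p : ℤ) ∣ nrdZ (x : B) := by
  obtain ⟨x, hx, hxp, hdvd⟩ := hO.exists_nrdZ_dvd_not_mem hp
  exact ⟨⟨x, hx⟩, fun h => hxp (res_eq_zero_iff.mp h), hdvd⟩

/-- `n(k · 1) = k²` on an order. [folklore] -/
theorem nrdZ_intCast (hO : IsZOrder O) (k : ℤ) : nrdZ ((k : ℤ) • (1 : B)) = k ^ 2 := by
  rw [hO.nrdZ_zsmul _ hO.one_mem, nrdZ_one, mul_one]

/-- **Dichotomy**: `O / p O` has a non-trivial idempotent or a non-zero element of square zero.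
From the isotropic `z = res x₀` (`n ≡ 0`, so `z² = t z`): if `p ∤ t` then `t⁻¹ z` is an idempotent,
`≠ 0`, and `≠ 1` (else `z` is a scalar of norm `t² ≢ 0`); if `p ∣ t` then `z² = 0`. [folklore] -/
theorem exists_idempotent_or_sq_zero (hO : IsZOrder O) (hp : p.Prime) :
    (∃ e : hO.Residue p, IsIdempotentElem e ∧ e ≠ 0 ∧ e ≠ 1) ∨
      ∃ z : hO.Residue p, z ≠ 0 ∧ z * z = 0 := by
  have hpZ : Prime (p : ℤ) := Nat.prime_iff_prime_int.mp hp
  obtain ⟨x, hx0, hn⟩ := hO.exists_res_ne_zero_dvd_nrdZ hp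
  set t : ℤ := trdZ (x : B) with ht_def
  have hn0 : (nrdZ (x : B) : hO.Residue p) = 0 := (hO.intCast_residue_eq_zero_iff hp).mpr hn
  have hsq : hO.res p x * hO.res p x = (t : hO.Residue p) * hO.res p x := by
    rw [hO.res_mul_res, hn0, sub_zero]
  by_cases ht : (p : ℤ) ∣ t
  · right
    refine ⟨hO.res p x, hx0, ?_⟩
    rw [hsq, (hO.intCast_residue_eq_zero_iff hp).mpr ht, zero_mul]
  · left
    obtain ⟨k, hk⟩ := hO.exists_intCast_mul_eq_one hp ht
    have hk' : (t : hO.Residue p) * (k : hO.Residue p) = 1 := by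
      rw [(Int.cast_commute t (k : hO.Residue p)).eq, hk]
    have hzk : hO.res p x = (t : hO.Residue p) * ((k : hO.Residue p) * hO.res p x) := by
      rw [← mul_assoc, hk', one_mul]
    refine ⟨(k : hO.Residue p) * hO.res p x, ?_, ?_, ?_⟩
    · -- idempotent: `(k z)² = k² z² = k² t z = k z`
      change (k : hO.Residue p) * hO.res p x * ((k : hO.Residue p) * hO.res p x) =
        (k : hO.Residue p) * hO.res p x
      have hck : hO.res p x * (k : hO.Residue p) = (k : hO.Residue p) * hO.res p x :=
        ((Int.cast_commute k (hO.res p x)).eq).symm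
      calc (k : hO.Residue p) * hO.res p x * ((k : hO.Residue p) * hO.res p x)
          = (k : hO.Residue p) * (hO.res p x * (k : hO.Residue p)) * hO.res p x := by noncomm_ring
        _ = (k : hO.Residue p) * ((k : hO.Residue p) * hO.res p x) * hO.res p x := by rw [hck]
        _ = (k : hO.Residue p) * (k : hO.Residue p) * (hO.res p x * hO.res p x) := by noncomm_ring
        _ = (k : hO.Residue p) * (k : hO.Residue p) * ((t : hO.Residue p) * hO.res p x) := by rw [hsq]
        _ = (k : hO.Residue p) * ((k : hO.Residue p) * (t : hO.Residue p)) * hO.res p x := by noncomm_ring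
        _ = (k : hO.Residue p) * hO.res p x := by rw [hk, mul_one]
    · intro h
      exact hx0 (by rw [hzk, h, mul_zero])
    · intro h
      -- then `z = t · 1` is a scalar, of norm `≡ t²`, contradicting `p ∣ n(x)`, `p ∤ t`
      have hz : hO.res p x = hO.res p (t : hO.subring) := by rw [hzk, h, mul_one, map_intCast]
      rw [res_eq_res_iff, Subring.coe_intCast] at hz
      obtain ⟨w, hw, hxw⟩ := (Submodule.mem_smul_pointwise_iff_exists _ _ O).mp hz
      have hxeq : (x : B) = (t : ℤ) • (1 : B) + (p : ℤ) • w := by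
        rw [hxw, zsmul_eq_mul, mul_one, add_sub_cancel]
      have hnrd := congrArg nrdZ hxeq
      rw [hO.nrdZ_add (O.smul_mem _ hO.one_mem) (O.smul_mem _ hw), hO.nrdZ_intCast,
        hO.nrdZ_zsmul _ hw, hO.polZ_zsmul _ _ hO.one_mem hw] at hnrd
      apply ht
      have h2 : (p : ℤ) ∣ t ^ 2 := by
        have : t ^ 2 = nrdZ (x : B) - (p : ℤ) * ((p : ℤ) * nrdZ w + t * polZ 1 w) := by
          rw [hnrd]; ring
        rw [this]
        exact dvd_sub hn (dvd_mul_right _ _)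
      exact hpZ.dvd_of_dvd_pow h2

end Residue

end IsZOrder

end Literature.NumberTheory.Automorphic

end
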